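import Summits.QuantumFields.YangMills.Theorems.BalabanUVNodesK0FlatCubeOpsTextP
import Summits.QuantumFields.YangMills.Theorems.UnitScaleTiltProp8FlatHBBound164
import Literature.MathematicalPhysics.QuantumFieldTheory.Balaban1983to89.B11Eq161HBChainLevelRadii
import HarnessLib

/-!
# K0⁷ `stub_prop8StepCoP13` (stmt-QuantumFields-20541), sub-target S5, S5 ROAD item (c): **[Balaban1985Variational] (161) ⇒ (164) IN THE CARRIER-GENERIC
# P2 LETTERS (`K0FlatCubeOpsTextP.HDecayLetterD ∕ RowSum162`), PRINT'S UNIFORM FORM AND THE LEVEL-DEPENDENT-RADII FORM OF NODE 00's ONE-STEP CURRENCY**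
# — the junction of the ym3-torus file `UnitScaleTiltProp8FlatHBBound164` (d = 3 letters) with g0's rate tilt `B11Eq161HBChainLevelRadii` (abstract geometry),
# typed ONCE over `(P : Params) (k : ℕ) (D : Domains P)`, so that the T⁴ instance `P := F.P K` (`F : T4Family`) is available to the S6 assembly by `rfl`

Cell `pub-ymgap`, width seat `pub-ymgap-k0-s1-w3` gen 2 (D-0149; START LIST v7 §k0-s1 S5 ROAD item (c), plan g80 WORDS-1b l.25728).
`--kind proof --supports stmt-QuantumFields-20541 --as helper`; count-neutral; def-free; CONSUMED BY NAME, nothing restated: the carrier-free reals lemmas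
`FlatHBBound164.exp_split ∕ kernelTerm_le ∕ quarter164_arith` (ym-ust-19200-w3) and `B11Eq161HBChainLevelRadii.tilt_far_le ∕ le_two_pow_mul_of_comparable` (g0).

THE PRINT (p. 303 [PDF 27]): *«|HB|, |∇^ηHB|, |∂^{η*}∂^ηHB|, |Δ^ηHB| ≦ B₀ Σ_{c∈ℭ_k} e^{−δ₀d(y₁,c₋)}(L^{j(c)}η)^{−1}|B(c)| < … (161) … Let us take B₃ = 72d³L³B₀ sup_{y₁}
Σ_{y₂∈ℭ_k} e^{−½δ₀d(y₁,y₂)}(d(y₁,y₂) + 1)(L^{j₂}η)^{−1}. (162)»*; p. 304: *«We may assume that R₁M₁ is sufficiently big, so that B₃e^{−½δ₀R₁M₁} ≦ ½. (163) Then we get on Δ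
|HB|, … < ¼M_Δ max{B₃ε₁, ½ε₀}. (164)»*.  The near cells carry (160) (`ε₁`), the far cells (155) `|B| < 18d²L³Mε₀` at distance `≥ R₁M₁` ((144)).

WHAT THIS FILE PROVES (`P : Params` any carrier, `k` the height, `D : Domains P` any nested family, `w` any weights with `0 ≤ w 1 b`, `dBI` any distance; `j(c) = c.1.1`):
* §1 `kernelSum_le_rowSum` · `effDatum_of_near_far` · `row_le_of_kernel` · `rows164_of_hDecayLetterD` · `rows164_quarter` — `FlatHBBound164` §1–§4 VERBATIM with the
  carrier generalised (`F.L ↦ P.L`, `K − n ↦ k`, `Fin 3 ↦ Fin P.d`): (161) ⇒ (161)₅·B₃ ⇒ (164) `≤ ¼M_Δ max{B₃′ε₁, ½ε₀}` from a NEAR bound `|X(c)| ≤ C·M_Δ·ε₁·(d+1)L^{k−j(c)}` and a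
  UNIFORM FAR bound `|X(c)| ≤ C·M_Δ·ε₀·L^{k−j(c)}` at distance `≥ R` and (163) `4CB₀B₃e^{−½δ₀R} ≤ ½`.
* §2 ★ `effDatum_of_near_far_levelRadii` · ★★ `rows164_quarter_levelRadii` · `rows164_quarter_levelRadii_of_comparable` — THE LEVEL-DEPENDENT-RADII FORM (NODE 00's
  one-step fact `Node00.HalvingStepTop` displays class radii `ε : ℕ → ℝ`, two-sided 2-comparable): the far cells at level `j(c)` carry `|X(c)| ≤ C·M_Δ·ε(j(c))·L^{k−j(c)}`
  with `ε(j) ≤ 2^{k−j}·ε(k)`, and besides (144) `R ≤ d(b,c)` the layer separation `G·(k − j(c) − g) ≤ d(b,c)` ([Balaban1984PropagatorsII] (2.60), the geometry (162)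
  already uses); a rate tilt `0 ≤ τ ≤ ½δ₀` with `2 ≤ e^{τG}` pays the factor `2^{k−j(c)}` (`tilt_far_le`), so the effective datum obeys print's shape with
  `β = C·M_Δ·max{ε₁, e^{−(½δ₀−τ)R}·2^g·ε(k)}` and (163′) `4CB₀B₃·e^{−(½δ₀−τ)R}·2^g ≤ θ` (far coefficient `θ` DISPLAYED; print `θ = ½`) lands the four rows at
  `≤ ¼M_Δ max{B₃′ε₁, θ·ε(k)}` — (164) in the level-`k` currency, the S5 letters `C := ¼M_Δ·B₃′`, `θ′ := ¼M_Δθ` of the S6 budget token.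
HONEST SCOPE: (160), (155), (144)∕(2.60), the operators and the letters' CONTENT are NOT proved here — they enter as the hypotheses `hnear`∕`hfar`∕`h60` and as the
letters `HDecayLetterD`∕`RowSum162` (supplied at d = 3 by the UST port, at general `d` by this lane's item (b)); the file is the by-name junction «P2 letters ⟹ the
¼-term of (165)∕(167)» in both currencies.  No definition, no sorry, standard axioms.  Count-neutral; K0⁷ OPEN; N07 NOT discharged (5∕27 unmoved); R4 closes the
conditional finite-𝕋⁴ rung `BalabanLadder.UV` only — the YM mass gap (Clay) is NOT proved by any of this; nothing continuum ∕ ℝ⁴ ∕ OS.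

References: T. Bałaban, CMP **102** (1985) 277–309 [Balaban1985Variational] (155) p.302, (160)–(163) p.303, (164)–(165) p.304, (144) p.300; CMP **96** (1984) 223–250
[Balaban1984PropagatorsII] (2.46) p.231, (2.60) p.234, Cor. 2.8 (2.150)–(2.151) p.249; CMP **119** (1988) 243–285 [Balaban1988Convergent] (2.7)–(2.8) pp.255–256.
-/

set_option autoImplicit false

noncomputable section

open scoped BigOperators

namespace Summit.QuantumFields.YangMills.Theorems.K0FlatHBBound164P

open Literature.MathematicalPhysics.QuantumFieldTheory.Balaban1983to89
open B6SectADomainsV1 (Domains)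
open B6SectAOperatorsV1 (BondIdx dcE dcsE)
open B11Eq161HBChainLevelRadii (tilt_far_le le_two_pow_mul_of_comparable)
open Summit.QuantumFields.YangMills.Theorems.FlatHBBound164 (exp_split kernelTerm_le quarter164_arith)
open Summit.QuantumFields.YangMills.Theorems.K0FlatCubeOpsTextP (HDecayLetterD RowSum162)

/-! ## §1 (161) ⇒ (164) in the carrier-generic P2 letters — print's uniform far radius -/

section Carrier

variable {P : Params} {k : ℕ} {D : Domains P}

/-- **(161)₁ ⇒ (161)₅, THE KERNEL SUM**: under the effective-datum bound at the fine bond `b`, `Σ_c e^{−δ₀d(b,c)}|X(c)| ≤ β·Σ_c e^{−½δ₀d(b,c)}(d(b,c) + 1)L^{k−j(c)}`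
— the inner sum of (162). [cite: Balaban1985Variational, (161)–(162) p.303] -/
theorem kernelSum_le_rowSum (dBI : PBond P 0 → BondIdx D → ℝ) {δ₀ β : ℝ} (X : BondIdx D → ℝ) (b : PBond P 0)
    (hX : ∀ c : BondIdx D, Real.exp (-(δ₀ / 2 * dBI b c)) * |X c| ≤ β * ((dBI b c + 1) * (P.L : ℝ) ^ (k - (c.1.1 : ℕ)))) :
    ∑ c, Real.exp (-(δ₀ * dBI b c)) * |X c| ≤ β * ∑ c, Real.exp (-(δ₀ / 2 * dBI b c)) * (dBI b c + 1) * (P.L : ℝ) ^ (k - (c.1.1 : ℕ)) := by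
  rw [Finset.mul_sum]
  exact Finset.sum_le_sum fun c _ => kernelTerm_le (hX c)

/-- **THE EFFECTIVE DATUM FROM (160) NEAR AND (155) FAR** (members 1 ≦ 4 of (161)): NEAR `|X(c)| ≤ β₁(d(b,c) + 1)L^{k−j(c)}`, FAR `|X(c)| ≤ β₂L^{k−j(c)}` with `R ≤ d(b,c)`,
`0 ≤ β₂`, `0 ≤ δ₀`, `0 ≤ d` ⇒ the effective bound with `β = max{β₁, e^{−½δ₀R}β₂}`. [cite: Balaban1985Variational, (155) p.302, (160)–(161) p.303, (144) p.300] -/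
theorem effDatum_of_near_far (dBI : PBond P 0 → BondIdx D → ℝ) {δ₀ β₁ β₂ R : ℝ} (hδ₀ : 0 ≤ δ₀) (hβ₂ : 0 ≤ β₂)
    (near : BondIdx D → Prop) (X : BondIdx D → ℝ) (b : PBond P 0) (hd : ∀ c, 0 ≤ dBI b c)
    (hnear : ∀ c, near c → |X c| ≤ β₁ * ((dBI b c + 1) * (P.L : ℝ) ^ (k - (c.1.1 : ℕ))))
    (hfar : ∀ c, ¬ near c → |X c| ≤ β₂ * (P.L : ℝ) ^ (k - (c.1.1 : ℕ)) ∧ R ≤ dBI b c) :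
    ∀ c : BondIdx D, Real.exp (-(δ₀ / 2 * dBI b c)) * |X c| ≤
      max β₁ (Real.exp (-(δ₀ / 2 * R)) * β₂) * ((dBI b c + 1) * (P.L : ℝ) ^ (k - (c.1.1 : ℕ))) := by
  intro c
  have hL0 : (0 : ℝ) ≤ (P.L : ℝ) ^ (k - (c.1.1 : ℕ)) := by positivity
  have hd1 : (0 : ℝ) ≤ dBI b c + 1 := by linarith [hd c]
  have hprod : 0 ≤ (dBI b c + 1) * (P.L : ℝ) ^ (k - (c.1.1 : ℕ)) := mul_nonneg hd1 hL0
  have hexp1 : Real.exp (-(δ₀ / 2 * dBI b c)) ≤ 1 := by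
    rw [Real.exp_le_one_iff]; nlinarith [hd c]
  by_cases hc : near c
  · calc Real.exp (-(δ₀ / 2 * dBI b c)) * |X c| ≤ 1 * |X c| :=
          mul_le_mul_of_nonneg_right hexp1 (abs_nonneg _)
      _ ≤ β₁ * ((dBI b c + 1) * (P.L : ℝ) ^ (k - (c.1.1 : ℕ))) := by rw [one_mul]; exact hnear c hc
      _ ≤ max β₁ (Real.exp (-(δ₀ / 2 * R)) * β₂) * ((dBI b c + 1) * (P.L : ℝ) ^ (k - (c.1.1 : ℕ))) :=
          mul_le_mul_of_nonneg_right (le_max_left _ _) hprod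
  · obtain ⟨hXc, hR⟩ := hfar c hc
    have hexpR : Real.exp (-(δ₀ / 2 * dBI b c)) ≤ Real.exp (-(δ₀ / 2 * R)) := by
      rw [Real.exp_le_exp]; nlinarith
    calc Real.exp (-(δ₀ / 2 * dBI b c)) * |X c|
        ≤ Real.exp (-(δ₀ / 2 * R)) * (β₂ * (P.L : ℝ) ^ (k - (c.1.1 : ℕ))) :=
          mul_le_mul hexpR hXc (abs_nonneg _) (Real.exp_nonneg _)
      _ = (Real.exp (-(δ₀ / 2 * R)) * β₂) * (1 * (P.L : ℝ) ^ (k - (c.1.1 : ℕ))) := by ring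
      _ ≤ (Real.exp (-(δ₀ / 2 * R)) * β₂) * ((dBI b c + 1) * (P.L : ℝ) ^ (k - (c.1.1 : ℕ))) :=
          mul_le_mul_of_nonneg_left (mul_le_mul_of_nonneg_right (by linarith [hd c]) hL0)
            (mul_nonneg (Real.exp_nonneg _) hβ₂)
      _ ≤ max β₁ (Real.exp (-(δ₀ / 2 * R)) * β₂) * ((dBI b c + 1) * (P.L : ℝ) ^ (k - (c.1.1 : ℕ))) :=
          mul_le_mul_of_nonneg_right (le_max_right _ _) hprod

/-- One row: `w₁(b)·Q ≤ w₁(b)·B₀Σ_c e^{−δ₀d}|X(c)| ≤ B₀·β·(w₁(b)Σ_c e^{−½δ₀d}(d+1)L^{…}) ≤ B₀·B₃·β`. [cite: Balaban1985Variational, (161)–(162) p.303] -/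
theorem row_le_of_kernel {dBI : PBond P 0 → BondIdx D → ℝ} {w : ℕ → PBond P 0 → ℝ} {δ₀ B₀ B₃ β Q : ℝ}
    (h162 : RowSum162 P k D dBI w δ₀ B₃) (hB₀ : 0 ≤ B₀) (hβ : 0 ≤ β) {X : BondIdx D → ℝ} {b : PBond P 0} (hwb : 0 ≤ w 1 b)
    (hX : ∀ c : BondIdx D, Real.exp (-(δ₀ / 2 * dBI b c)) * |X c| ≤ β * ((dBI b c + 1) * (P.L : ℝ) ^ (k - (c.1.1 : ℕ))))
    (hQ : Q ≤ B₀ * ∑ c, Real.exp (-(δ₀ * dBI b c)) * |X c|) :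
    w 1 b * Q ≤ B₀ * B₃ * β := by
  have hsum := kernelSum_le_rowSum dBI X b hX
  calc w 1 b * Q ≤ w 1 b * (B₀ * ∑ c, Real.exp (-(δ₀ * dBI b c)) * |X c|) := mul_le_mul_of_nonneg_left hQ hwb
    _ ≤ w 1 b * (B₀ * (β * ∑ c, Real.exp (-(δ₀ / 2 * dBI b c)) * (dBI b c + 1) * (P.L : ℝ) ^ (k - (c.1.1 : ℕ)))) :=
        mul_le_mul_of_nonneg_left (mul_le_mul_of_nonneg_left hsum hB₀) hwb
    _ = B₀ * β * (w 1 b * ∑ c, Real.exp (-(δ₀ / 2 * dBI b c)) * (dBI b c + 1) * (P.L : ℝ) ^ (k - (c.1.1 : ℕ))) := by ring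
    _ ≤ B₀ * β * B₃ := mul_le_mul_of_nonneg_left (h162 b) (mul_nonneg hB₀ hβ)
    _ = B₀ * B₃ * β := by ring

/-- **(161) IN THE CARRIER-GENERIC P2 LETTERS — THE FOUR ROWS**: `HDecayLetterD P k D dBI w H B₀ δ₀` ((161)₁) ∧ `RowSum162 P k D dBI w δ₀ B₃` ((162)) ∧ the effective-datum
bound at `b` ⇒ the four left-weighted quantities `|HX|`, `∇^η HX` (every direction `ν : Fin P.d`), `∂^{η*}∂^η HX`, `Δ^η HX` at `b` are `≤ B₀·B₃·β`.
[cite: Balaban1985Variational, (161)–(162) p.303] -/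
theorem rows164_of_hDecayLetterD {dBI : PBond P 0 → BondIdx D → ℝ} {w : ℕ → PBond P 0 → ℝ}
    {H : (BondIdx D → ℝ) →ₗ[ℝ] (PBond P 0 → ℝ)} {δ₀ B₀ B₃ β : ℝ}
    (hH : HDecayLetterD P k D dBI w H B₀ δ₀) (h162 : RowSum162 P k D dBI w δ₀ B₃) (hB₀ : 0 ≤ B₀) (hβ : 0 ≤ β)
    {X : BondIdx D → ℝ} {b : PBond P 0} (hwb : 0 ≤ w 1 b)
    (hX : ∀ c : BondIdx D, Real.exp (-(δ₀ / 2 * dBI b c)) * |X c| ≤ β * ((dBI b c + 1) * (P.L : ℝ) ^ (k - (c.1.1 : ℕ)))) :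
    w 1 b * (w 1 b * |H X b|) ≤ B₀ * B₃ * β ∧
    (∀ ν : Fin P.d, w 1 b * (w 2 b * (P.L : ℝ) ^ k * |H X ⟨b.src.shift ν, b.dir⟩ - H X b|) ≤ B₀ * B₃ * β) ∧
    w 1 b * (w 3 b * |(dcsE ((P.L : ℝ) ^ k) (dcE ((P.L : ℝ) ^ k) (WithLp.toLp 2 (H X)))) b|) ≤ B₀ * B₃ * β ∧
    w 1 b * (w 3 b * ((P.L : ℝ) ^ k) ^ 2 *
        |∑ ν : Fin P.d, ((H X b - H X ⟨b.src.shift ν, b.dir⟩) + (H X b - H X ⟨b.src.unshift ν, b.dir⟩))|) ≤ B₀ * B₃ * β := by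
  obtain ⟨h1, h2, h3, h4⟩ := hH X b
  exact ⟨row_le_of_kernel h162 hB₀ hβ hwb hX h1, fun ν => row_le_of_kernel h162 hB₀ hβ hwb hX (h2 ν),
    row_le_of_kernel h162 hB₀ hβ hwb hX h3, row_le_of_kernel h162 hB₀ hβ hwb hX h4⟩

/-- **(164) IN THE CARRIER-GENERIC P2 LETTERS, PRINT'S UNIFORM FAR RADIUS** (§1 + `FlatHBBound164.quarter164_arith`): `HDecayLetterD` ∧ `RowSum162` ∧ NEAR datum
`|X(c)| ≤ C·M_Δ·ε₁·(d+1)L^{k−j(c)}` ((160)) ∧ FAR datum `|X(c)| ≤ C·M_Δ·ε₀·L^{k−j(c)}` at distance `≥ R₁M₁` ((155), (144)) ∧ (163) `4CB₀B₃e^{−½δ₀R₁M₁} ≤ ½` ⇒ the four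
left-weighted rows at `b` are `≤ ¼M_Δ·max{B₃′ε₁, ½ε₀}`, `B₃′ = 4CB₀B₃`. [cite: Balaban1985Variational, (160)–(164) pp.303–304] -/
theorem rows164_quarter {dBI : PBond P 0 → BondIdx D → ℝ} {w : ℕ → PBond P 0 → ℝ}
    {H : (BondIdx D → ℝ) →ₗ[ℝ] (PBond P 0 → ℝ)} {δ₀ B₀ B₃ C MΔ ε₁ ε₀ R₁M₁ : ℝ}
    (hH : HDecayLetterD P k D dBI w H B₀ δ₀) (h162 : RowSum162 P k D dBI w δ₀ B₃) (hδ₀ : 0 ≤ δ₀) (hB₀ : 0 ≤ B₀) (hB₃ : 0 ≤ B₃)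
    (hC : 0 ≤ C) (hM : 0 ≤ MΔ) (hε₁ : 0 ≤ ε₁) (hε₀ : 0 ≤ ε₀)
    (h163 : 4 * C * B₀ * B₃ * Real.exp (-(δ₀ / 2 * R₁M₁)) ≤ 1 / 2)
    (near : BondIdx D → Prop) {X : BondIdx D → ℝ} {b : PBond P 0} (hwb : 0 ≤ w 1 b) (hd : ∀ c, 0 ≤ dBI b c)
    (hnear : ∀ c, near c → |X c| ≤ C * MΔ * ε₁ * ((dBI b c + 1) * (P.L : ℝ) ^ (k - (c.1.1 : ℕ))))
    (hfar : ∀ c, ¬ near c → |X c| ≤ C * MΔ * ε₀ * (P.L : ℝ) ^ (k - (c.1.1 : ℕ)) ∧ R₁M₁ ≤ dBI b c) :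
    w 1 b * (w 1 b * |H X b|) ≤ 1 / 4 * MΔ * max (4 * C * B₀ * B₃ * ε₁) (ε₀ / 2) ∧
    (∀ ν : Fin P.d, w 1 b * (w 2 b * (P.L : ℝ) ^ k * |H X ⟨b.src.shift ν, b.dir⟩ - H X b|) ≤
      1 / 4 * MΔ * max (4 * C * B₀ * B₃ * ε₁) (ε₀ / 2)) ∧
    w 1 b * (w 3 b * |(dcsE ((P.L : ℝ) ^ k) (dcE ((P.L : ℝ) ^ k) (WithLp.toLp 2 (H X)))) b|) ≤
      1 / 4 * MΔ * max (4 * C * B₀ * B₃ * ε₁) (ε₀ / 2) ∧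
    w 1 b * (w 3 b * ((P.L : ℝ) ^ k) ^ 2 *
        |∑ ν : Fin P.d, ((H X b - H X ⟨b.src.shift ν, b.dir⟩) + (H X b - H X ⟨b.src.unshift ν, b.dir⟩))|) ≤
      1 / 4 * MΔ * max (4 * C * B₀ * B₃ * ε₁) (ε₀ / 2) := by
  set θ : ℝ := Real.exp (-(δ₀ / 2 * R₁M₁)) with hθ
  have hβ₂ : 0 ≤ C * MΔ * ε₀ := by positivity
  have hX := effDatum_of_near_far dBI hδ₀ hβ₂ near X b hd hnear hfar
  have hβeq : max (C * MΔ * ε₁) (θ * (C * MΔ * ε₀)) = C * MΔ * max ε₁ (θ * ε₀) := by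
    have hcm : 0 ≤ C * MΔ := by positivity
    rw [show θ * (C * MΔ * ε₀) = C * MΔ * (θ * ε₀) by ring, ← mul_max_of_nonneg _ _ hcm]
  rw [hβeq] at hX
  have hβ : 0 ≤ C * MΔ * max ε₁ (θ * ε₀) := mul_nonneg (by positivity) (le_max_of_le_left hε₁)
  obtain ⟨r1, r2, r3, r4⟩ := rows164_of_hDecayLetterD hH h162 hB₀ hβ hwb hX
  have hq := quarter164_arith (ε₁ := ε₁) hB₀ hB₃ hC hM hε₀ h163
  exact ⟨r1.trans hq, fun ν => (r2 ν).trans hq, r3.trans hq, r4.trans hq⟩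

end Carrier

/-! ## §2 (161) ⇒ (164) with LEVEL-DEPENDENT far radii (NODE 00's one-step currency): the rate tilt in the P2 letters -/

section LevelRadii

variable {P : Params} {k : ℕ} {D : Domains P}

/-- **THE EFFECTIVE DATUM WITH LEVEL-DEPENDENT FAR RADII**: NEAR `|X(c)| ≤ β₁(d(b,c) + 1)L^{k−j(c)}` ((160)); FAR, at the radius of the cell's OWN level,
`|X(c)| ≤ β₂·ε(j(c))·L^{k−j(c)}` with `ε(j) ≤ 2^{k−j}·ε(k)` (`j ≤ k`), `0 ≤ ε(k)`, the (144) separation `R ≤ d(b,c)` AND the layer separation `G·(k − j(c) − g) ≤ d(b,c)`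
([Balaban1984PropagatorsII] (2.60)); a rate tilt `0 ≤ τ ≤ ½δ₀` with `2 ≤ e^{τG}` pays the factor `2^{k−j(c)}` (`B11Eq161HBChainLevelRadii.tilt_far_le`), so the effective bound
of §1 holds with `β = max{β₁, e^{−(½δ₀−τ)R}·2^g·β₂·ε(k)}` — print's shape (member 4 of (161)) at `ε₀ := 2^g·ε(k)` and far rate `½δ₀ − τ`.
[cite: Balaban1985Variational, (155) p.302, (160)–(161) p.303, (144) p.300; Balaban1984PropagatorsII, (2.60) p.234] -/
theorem effDatum_of_near_far_levelRadii (dBI : PBond P 0 → BondIdx D → ℝ) {δ₀ τ β₁ β₂ R G : ℝ} {ε : ℕ → ℝ} {gap : ℕ}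
    (hτ : 0 ≤ τ) (hτδ : τ ≤ δ₀ / 2) (h2 : 2 ≤ Real.exp (τ * G)) (hβ₂ : 0 ≤ β₂) (hεk : 0 ≤ ε k)
    (hεcomp : ∀ j, j ≤ k → ε j ≤ (2 : ℝ) ^ (k - j) * ε k)
    (near : BondIdx D → Prop) (X : BondIdx D → ℝ) (b : PBond P 0) (hd : ∀ c, 0 ≤ dBI b c) (hjk : ∀ c : BondIdx D, (c.1.1 : ℕ) ≤ k)
    (hnear : ∀ c, near c → |X c| ≤ β₁ * ((dBI b c + 1) * (P.L : ℝ) ^ (k - (c.1.1 : ℕ))))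
    (hfar : ∀ c, ¬ near c →
      |X c| ≤ β₂ * ε (c.1.1 : ℕ) * (P.L : ℝ) ^ (k - (c.1.1 : ℕ)) ∧ R ≤ dBI b c ∧ G * ((k : ℝ) - (c.1.1 : ℕ) - gap) ≤ dBI b c) :
    ∀ c : BondIdx D, Real.exp (-(δ₀ / 2 * dBI b c)) * |X c| ≤
      max β₁ (Real.exp (-((δ₀ / 2 - τ) * R)) * (2 : ℝ) ^ gap * β₂ * ε k) * ((dBI b c + 1) * (P.L : ℝ) ^ (k - (c.1.1 : ℕ))) := by
  intro c
  have hL0 : (0 : ℝ) ≤ (P.L : ℝ) ^ (k - (c.1.1 : ℕ)) := by positivity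
  have hd1 : (0 : ℝ) ≤ dBI b c + 1 := by linarith [hd c]
  have hprod : 0 ≤ (dBI b c + 1) * (P.L : ℝ) ^ (k - (c.1.1 : ℕ)) := mul_nonneg hd1 hL0
  by_cases hc : near c
  · have hexp1 : Real.exp (-(δ₀ / 2 * dBI b c)) ≤ 1 := by
      rw [Real.exp_le_one_iff]; nlinarith [hd c]
    calc Real.exp (-(δ₀ / 2 * dBI b c)) * |X c| ≤ 1 * |X c| :=
          mul_le_mul_of_nonneg_right hexp1 (abs_nonneg _)
      _ ≤ β₁ * ((dBI b c + 1) * (P.L : ℝ) ^ (k - (c.1.1 : ℕ))) := by rw [one_mul]; exact hnear c hc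
      _ ≤ max β₁ (Real.exp (-((δ₀ / 2 - τ) * R)) * (2 : ℝ) ^ gap * β₂ * ε k) * ((dBI b c + 1) * (P.L : ℝ) ^ (k - (c.1.1 : ℕ))) :=
          mul_le_mul_of_nonneg_right (le_max_left _ _) hprod
  · obtain ⟨hXc, hR, h60⟩ := hfar c hc
    -- the tilt: `e^{−½δ₀d} = e^{−(½δ₀−τ)d}·e^{−τd}`, `e^{−(½δ₀−τ)d} ≤ e^{−(½δ₀−τ)R}`, `e^{−τd}·2^{k−j} ≤ 2^g`
    have hsplit : Real.exp (-(δ₀ / 2 * dBI b c)) = Real.exp (-((δ₀ / 2 - τ) * dBI b c)) * Real.exp (-(τ * dBI b c)) := by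
      rw [← Real.exp_add]; congr 1; ring
    have hexpR : Real.exp (-((δ₀ / 2 - τ) * dBI b c)) ≤ Real.exp (-((δ₀ / 2 - τ) * R)) := by
      rw [Real.exp_le_exp]; nlinarith
    have htilt := tilt_far_le (k := k) (j := (c.1.1 : ℕ)) (gap := gap) hτ h2 (hd c) (hjk c) h60
    have hfarX : |X c| ≤ β₂ * ((2 : ℝ) ^ (k - (c.1.1 : ℕ)) * ε k) * (P.L : ℝ) ^ (k - (c.1.1 : ℕ)) :=
      hXc.trans (mul_le_mul_of_nonneg_right (mul_le_mul_of_nonneg_left (hεcomp _ (hjk c)) hβ₂) hL0)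
    have hK : 0 ≤ Real.exp (-((δ₀ / 2 - τ) * R)) * (2 : ℝ) ^ gap * β₂ * ε k := by positivity
    calc Real.exp (-(δ₀ / 2 * dBI b c)) * |X c|
        ≤ (Real.exp (-((δ₀ / 2 - τ) * R)) * Real.exp (-(τ * dBI b c))) *
            (β₂ * ((2 : ℝ) ^ (k - (c.1.1 : ℕ)) * ε k) * (P.L : ℝ) ^ (k - (c.1.1 : ℕ))) := by
          rw [hsplit]
          exact mul_le_mul (mul_le_mul_of_nonneg_right hexpR (Real.exp_nonneg _)) hfarX (abs_nonneg _)
            (mul_nonneg (Real.exp_nonneg _) (Real.exp_nonneg _))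
      _ = Real.exp (-((δ₀ / 2 - τ) * R)) * (Real.exp (-(τ * dBI b c)) * (2 : ℝ) ^ (k - (c.1.1 : ℕ))) * β₂ * ε k *
            (1 * (P.L : ℝ) ^ (k - (c.1.1 : ℕ))) := by ring
      _ ≤ Real.exp (-((δ₀ / 2 - τ) * R)) * (2 : ℝ) ^ gap * β₂ * ε k * (1 * (P.L : ℝ) ^ (k - (c.1.1 : ℕ))) := by
          have h1 : 0 ≤ 1 * (P.L : ℝ) ^ (k - (c.1.1 : ℕ)) := by rw [one_mul]; exact hL0
          refine mul_le_mul_of_nonneg_right ?_ h1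
          exact mul_le_mul_of_nonneg_right (mul_le_mul_of_nonneg_right
            (mul_le_mul_of_nonneg_left htilt (Real.exp_nonneg _)) hβ₂) hεk
      _ ≤ Real.exp (-((δ₀ / 2 - τ) * R)) * (2 : ℝ) ^ gap * β₂ * ε k * ((dBI b c + 1) * (P.L : ℝ) ^ (k - (c.1.1 : ℕ))) :=
          mul_le_mul_of_nonneg_left (mul_le_mul_of_nonneg_right (by linarith [hd c]) hL0) hK
      _ ≤ max β₁ (Real.exp (-((δ₀ / 2 - τ) * R)) * (2 : ℝ) ^ gap * β₂ * ε k) * ((dBI b c + 1) * (P.L : ℝ) ^ (k - (c.1.1 : ℕ))) :=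
          mul_le_mul_of_nonneg_right (le_max_right _ _) hprod

/-- ★★ **(164) WITH LEVEL-DEPENDENT FAR RADII IN THE P2 LETTERS** (NODE 00's one-step currency; print's shape at `θ = ½`, `g = 0`, `ε ≡ ε₀`): `HDecayLetterD` ∧ `RowSum162` ∧
NEAR datum `|X(c)| ≤ C·M_Δ·ε₁·(d+1)L^{k−j(c)}` ((160) at `ε₁ := 2δ_k`) ∧ FAR datum `|X(c)| ≤ C·M_Δ·ε(j(c))·L^{k−j(c)}` ((155) at the CLASS RADIUS OF THE CELL'S LEVEL, `ε(j) ≤ 2^{k−j}ε(k)`)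
behind `R ≤ d(b,c)` ((144)) and `G·(k − j(c) − g) ≤ d(b,c)` ((2.60)) ∧ a tilt `0 ≤ τ ≤ ½δ₀`, `2 ≤ e^{τG}` ∧ (163′) `4CB₀B₃·e^{−(½δ₀−τ)R}·2^g ≤ θ` (far coefficient `θ`
DISPLAYED) ⇒ the four left-weighted rows at `b` are `≤ ¼M_Δ·max{B₃′ε₁, θ·ε(k)}`, `B₃′ = 4CB₀B₃` — the S5 letters `C := ¼M_Δ B₃′`, `θ′ := ¼M_Δθ` of the S6 budget token.
[cite: Balaban1985Variational, (155) p.302, (160)–(164) pp.303–304, (144) p.300; Balaban1984PropagatorsII, (2.60) p.234] -/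
theorem rows164_quarter_levelRadii {dBI : PBond P 0 → BondIdx D → ℝ} {w : ℕ → PBond P 0 → ℝ}
    {H : (BondIdx D → ℝ) →ₗ[ℝ] (PBond P 0 → ℝ)} {δ₀ τ B₀ B₃ C MΔ ε₁ R G θ : ℝ} {ε : ℕ → ℝ} {gap : ℕ}
    (hH : HDecayLetterD P k D dBI w H B₀ δ₀) (h162 : RowSum162 P k D dBI w δ₀ B₃) (hB₀ : 0 ≤ B₀) (hB₃ : 0 ≤ B₃)
    (hC : 0 ≤ C) (hM : 0 ≤ MΔ) (hε₁ : 0 ≤ ε₁) (hεk : 0 ≤ ε k) (hεcomp : ∀ j, j ≤ k → ε j ≤ (2 : ℝ) ^ (k - j) * ε k)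
    (hτ : 0 ≤ τ) (hτδ : τ ≤ δ₀ / 2) (h2 : 2 ≤ Real.exp (τ * G))
    (h163 : 4 * C * B₀ * B₃ * (Real.exp (-((δ₀ / 2 - τ) * R)) * (2 : ℝ) ^ gap) ≤ θ)
    (near : BondIdx D → Prop) {X : BondIdx D → ℝ} {b : PBond P 0} (hwb : 0 ≤ w 1 b) (hd : ∀ c, 0 ≤ dBI b c) (hjk : ∀ c : BondIdx D, (c.1.1 : ℕ) ≤ k)
    (hnear : ∀ c, near c → |X c| ≤ C * MΔ * ε₁ * ((dBI b c + 1) * (P.L : ℝ) ^ (k - (c.1.1 : ℕ))))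
    (hfar : ∀ c, ¬ near c →
      |X c| ≤ C * MΔ * ε (c.1.1 : ℕ) * (P.L : ℝ) ^ (k - (c.1.1 : ℕ)) ∧ R ≤ dBI b c ∧ G * ((k : ℝ) - (c.1.1 : ℕ) - gap) ≤ dBI b c) :
    w 1 b * (w 1 b * |H X b|) ≤ 1 / 4 * MΔ * max (4 * C * B₀ * B₃ * ε₁) (θ * ε k) ∧
    (∀ ν : Fin P.d, w 1 b * (w 2 b * (P.L : ℝ) ^ k * |H X ⟨b.src.shift ν, b.dir⟩ - H X b|) ≤
      1 / 4 * MΔ * max (4 * C * B₀ * B₃ * ε₁) (θ * ε k)) ∧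
    w 1 b * (w 3 b * |(dcsE ((P.L : ℝ) ^ k) (dcE ((P.L : ℝ) ^ k) (WithLp.toLp 2 (H X)))) b|) ≤
      1 / 4 * MΔ * max (4 * C * B₀ * B₃ * ε₁) (θ * ε k) ∧
    w 1 b * (w 3 b * ((P.L : ℝ) ^ k) ^ 2 *
        |∑ ν : Fin P.d, ((H X b - H X ⟨b.src.shift ν, b.dir⟩) + (H X b - H X ⟨b.src.unshift ν, b.dir⟩))|) ≤
      1 / 4 * MΔ * max (4 * C * B₀ * B₃ * ε₁) (θ * ε k) := by
  -- the tilted remoteness factor `ϑ := e^{−(½δ₀−τ)R}·2^g` plays print's `e^{−½δ₀R₁M₁}`, `ε(k)` plays `ε₀`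
  set ϑ : ℝ := Real.exp (-((δ₀ / 2 - τ) * R)) * (2 : ℝ) ^ gap with hϑ
  have hϑ0 : 0 ≤ ϑ := by positivity
  have hβ₂ : 0 ≤ C * MΔ := by positivity
  have hX := effDatum_of_near_far_levelRadii dBI hτ hτδ h2 hβ₂ hεk hεcomp near X b hd hjk hnear hfar
  have hβeq : max (C * MΔ * ε₁) (Real.exp (-((δ₀ / 2 - τ) * R)) * (2 : ℝ) ^ gap * (C * MΔ) * ε k) = C * MΔ * max ε₁ (ϑ * ε k) := by
    rw [show Real.exp (-((δ₀ / 2 - τ) * R)) * (2 : ℝ) ^ gap * (C * MΔ) * ε k = C * MΔ * (ϑ * ε k) by rw [hϑ]; ring,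
      ← mul_max_of_nonneg _ _ hβ₂]
  rw [hβeq] at hX
  have hβ : 0 ≤ C * MΔ * max ε₁ (ϑ * ε k) := mul_nonneg hβ₂ (le_max_of_le_left hε₁)
  obtain ⟨r1, r2, r3, r4⟩ := rows164_of_hDecayLetterD hH h162 hB₀ hβ hwb hX
  -- (163′) ⇒ the quarter, with `θ·ε(k)` in place of `½ε₀`
  have hKc : 0 ≤ 4 * C * B₀ * B₃ := by positivity
  have hmax : 4 * C * B₀ * B₃ * max ε₁ (ϑ * ε k) ≤ max (4 * C * B₀ * B₃ * ε₁) (θ * ε k) := by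
    rcases le_total ε₁ (ϑ * ε k) with h | h
    · rw [max_eq_right h]
      calc 4 * C * B₀ * B₃ * (ϑ * ε k) = (4 * C * B₀ * B₃ * ϑ) * ε k := by ring
        _ ≤ θ * ε k := mul_le_mul_of_nonneg_right h163 hεk
        _ ≤ max (4 * C * B₀ * B₃ * ε₁) (θ * ε k) := le_max_right _ _
    · rw [max_eq_left h]
      exact le_max_left _ _
  have hq : B₀ * B₃ * (C * MΔ * max ε₁ (ϑ * ε k)) ≤ 1 / 4 * MΔ * max (4 * C * B₀ * B₃ * ε₁) (θ * ε k) :=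
    calc B₀ * B₃ * (C * MΔ * max ε₁ (ϑ * ε k)) = 1 / 4 * MΔ * (4 * C * B₀ * B₃ * max ε₁ (ϑ * ε k)) := by ring
      _ ≤ 1 / 4 * MΔ * max (4 * C * B₀ * B₃ * ε₁) (θ * ε k) := mul_le_mul_of_nonneg_left hmax (by positivity)
  exact ⟨r1.trans hq, fun ν => (r2 ν).trans hq, r3.trans hq, r4.trans hq⟩

/-- **(164) with level-dependent far radii, COMPARABILITY FORM**: the same with the far-cell radii controlled by NODE 00's two-sided comparability binder `ε n ≤ 2ε(n+1)`
(`n < k`) instead of the closed form `ε j ≤ 2^{k−j}ε k` (`B11Eq161HBChainLevelRadii.le_two_pow_mul_of_comparable`); far coefficient `θ` displayed.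
[cite: Balaban1985Variational, (164) p.304; Balaban1988Convergent, (2.7)–(2.8) pp.255–256] -/
theorem rows164_quarter_levelRadii_of_comparable {dBI : PBond P 0 → BondIdx D → ℝ} {w : ℕ → PBond P 0 → ℝ}
    {H : (BondIdx D → ℝ) →ₗ[ℝ] (PBond P 0 → ℝ)} {δ₀ τ B₀ B₃ C MΔ ε₁ R G θ : ℝ} {ε : ℕ → ℝ} {gap : ℕ}
    (hH : HDecayLetterD P k D dBI w H B₀ δ₀) (h162 : RowSum162 P k D dBI w δ₀ B₃) (hB₀ : 0 ≤ B₀) (hB₃ : 0 ≤ B₃)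
    (hC : 0 ≤ C) (hM : 0 ≤ MΔ) (hε₁ : 0 ≤ ε₁) (hεk : 0 ≤ ε k) (hcomp : ∀ n, n < k → ε n ≤ 2 * ε (n + 1))
    (hτ : 0 ≤ τ) (hτδ : τ ≤ δ₀ / 2) (h2 : 2 ≤ Real.exp (τ * G))
    (h163 : 4 * C * B₀ * B₃ * (Real.exp (-((δ₀ / 2 - τ) * R)) * (2 : ℝ) ^ gap) ≤ θ)
    (near : BondIdx D → Prop) {X : BondIdx D → ℝ} {b : PBond P 0} (hwb : 0 ≤ w 1 b) (hd : ∀ c, 0 ≤ dBI b c) (hjk : ∀ c : BondIdx D, (c.1.1 : ℕ) ≤ k)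
    (hnear : ∀ c, near c → |X c| ≤ C * MΔ * ε₁ * ((dBI b c + 1) * (P.L : ℝ) ^ (k - (c.1.1 : ℕ))))
    (hfar : ∀ c, ¬ near c →
      |X c| ≤ C * MΔ * ε (c.1.1 : ℕ) * (P.L : ℝ) ^ (k - (c.1.1 : ℕ)) ∧ R ≤ dBI b c ∧ G * ((k : ℝ) - (c.1.1 : ℕ) - gap) ≤ dBI b c) :
    w 1 b * (w 1 b * |H X b|) ≤ 1 / 4 * MΔ * max (4 * C * B₀ * B₃ * ε₁) (θ * ε k) ∧
    (∀ ν : Fin P.d, w 1 b * (w 2 b * (P.L : ℝ) ^ k * |H X ⟨b.src.shift ν, b.dir⟩ - H X b|) ≤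
      1 / 4 * MΔ * max (4 * C * B₀ * B₃ * ε₁) (θ * ε k)) ∧
    w 1 b * (w 3 b * |(dcsE ((P.L : ℝ) ^ k) (dcE ((P.L : ℝ) ^ k) (WithLp.toLp 2 (H X)))) b|) ≤
      1 / 4 * MΔ * max (4 * C * B₀ * B₃ * ε₁) (θ * ε k) ∧
    w 1 b * (w 3 b * ((P.L : ℝ) ^ k) ^ 2 *
        |∑ ν : Fin P.d, ((H X b - H X ⟨b.src.shift ν, b.dir⟩) + (H X b - H X ⟨b.src.unshift ν, b.dir⟩))|) ≤
      1 / 4 * MΔ * max (4 * C * B₀ * B₃ * ε₁) (θ * ε k) :=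
  rows164_quarter_levelRadii hH h162 hB₀ hB₃ hC hM hε₁ hεk (fun _ hj => le_two_pow_mul_of_comparable hcomp hj) hτ hτδ h2 h163
    near hwb hd hjk hnear hfar

/-- **the index bonds of a family sit at levels `≤ D.k`** — the binder `hjk` above at `k := D.k` (or any `k` with `D.k = k`). [cite: Balaban1984PropagatorsII, (2.3) p.224] -/
theorem bondIdx_level_le {k' : ℕ} (hDk : D.k = k') (c : BondIdx D) : (c.1.1 : ℕ) ≤ k' := by
  have := c.1.1.isLt
  omega

end LevelRadii

end Summit.QuantumFields.YangMills.Theorems.K0FlatHBBound164P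

end
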